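import Literature.Analysis.FluidPDE.NSGalerkinDifferenceIdentities
import HarnessLib

/-!
# Galerkin fields along a continuous coefficient curve: joint continuity, and the measurability
  and integrability in time of the slice functionals against a Leray–Hopf solution

Analysis/FluidPDE support file (file 3 of the discharge of
`Literature.Analysis.FluidPDE.galerkin_tendsto_lerayHopf_torus2`, `NSEnstrophyBalance2DGalerkin`;
Foias–Manley–Rosa–Temam 2001, Ch. II Thm. 7.3, by Serrin's weak–strong energy method with the
Galerkin approximation `U(s) = realTrigPoly S (α s)‾` in the role of the strong solution). The
energy inequality for `w = u - U` (next file) integrates in time several slice functionals of a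
Leray–Hopf solution `u` on `T^d × [0, T)` against fields built from `U`; this file proves, in
every dimension, that they are integrable on `(0, T)`:

* `Torus.IsLerayHopfOn.integrableOn_integral_norm_sub_sq` — `s ↦ ∫ ‖u(s) - Z(s)‖²`,
* `Torus.IsLerayHopfOn.integrableOn_integral_inner_prod` — `s ↦ ∫ ⟪u(s), Z(s)⟫`,
  for every field `Z` continuous on `[0, T] × T^d` (Fubini measurability of the jointly
  measurable integrand, `Torus.IsLerayHopfOn.aestronglyMeasurable_uncurry`, and the a.e. energy
  bound `Torus.IsLerayHopfOn.exists_integral_norm_sq_le`);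
* `Torus.IsLerayHopfOn.integrableOn_trilinear_sub_galerkin` — the trilinear slice functional
  `s ↦ ∫ ⟪w(s), (w(s)·∇)U(s)⟫`, `w = u - U` (bounded by `(sup ∑ᵢ‖∂ᵢU‖) ∫‖w(s)‖²`);
* `Torus.IsLerayHopfOn.integrableOn_truncation_trilinear_galerkin` —
  `s ↦ ∫ ⟪u(s) - P_S u(s), (U(s)·∇)U(s)⟫`, the truncation moved across the pairing
  (`integral_inner_sub_truncation_comm`) onto the explicit trigonometric polynomial
  `P_S((U·∇)U) = realTrigPoly S (convectionCoeff …)`;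
* `Torus.IsLerayHopfOn.integrableOn_integral_inner_laplacian_galerkin` — `s ↦ ∫ ⟪u(s), ΔU(s)⟫`,
  and `continuousOn_toReal_eGradNormSq_galerkin` — continuity of `s ↦ ‖∇U(s)‖₂²`;

together with the joint continuity on `I × T^d` of `U`, `∂ⱼU`, `(U·∇)U`, `ΔU` along a coefficient
curve continuous on `I` (`continuousOn_realTrigPoly_prod` and its corollaries).

## Mathlib / tree search

`ContinuousOn.aestronglyMeasurable`, `AEStronglyMeasurable.integral_prod_right'`,
`IsCompact.exists_bound_of_continuousOn` (Mathlib); the whole-space analogue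
`aestronglyMeasurable_prod_of_continuousOn` (`ClassicalSolutionCalculus`) is restated here for
the torus (`Torus.aestronglyMeasurable_prod_of_continuousOn_Icc`). The slice bounds
(`abs_integral_inner_le_of_norm_le`, `integral_norm_le_of_memLp_two`, `norm_convect_le`) are the
accepted ones of `LerayHopfTimeSliceTorus` / `TorusFourierModes`.

## References

* J. Serrin, *The initial value problem for the Navier–Stokes equations* (1963), §4.
* J. C. Robinson, J. L. Rodrigo, W. Sadowski, *The three-dimensional Navier–Stokes equations*,
  CUP 2016, Thm. 4.4, Lemma 8.18.
* C. Foias, O. Manley, R. Rosa, R. Temam, *Navier–Stokes Equations and Turbulence*, CUP 2001,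
  Ch. II §7, Thm. 7.3.
-/

noncomputable section

open MeasureTheory TopologicalSpace Set Function Filter UnitAddTorus
open scoped InnerProductSpace RealInnerProductSpace ENNReal NNReal Topology

namespace Literature.Analysis.FluidPDE

open FunctionSpaces.Torus Torus

/-! ### Galerkin fields along a continuous coefficient curve: joint continuity -/

section Curve

variable {d : Type*} [Fintype d] [DecidableEq d] {S : Finset (d → ℤ)} {I : Set ℝ}

omit [DecidableEq d] in
/-- Joint continuity of `(s, x) ↦ realTrigPoly S (ζ s) x` on `I × T^d` when the coefficients
`s ↦ ζ s k`, `k ∈ S`, are continuous on `I`. [folklore] -/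
theorem continuousOn_realTrigPoly_prod {ζ : ℝ → (d → ℤ) → EuclideanSpace ℂ d}
    (hζ : ∀ k ∈ S, ContinuousOn (fun s => ζ s k) I) :
    ContinuousOn (fun p : ℝ × UnitAddTorus d => realTrigPoly S (ζ p.1) p.2) (I ×ˢ univ) := by
  have h : (fun p : ℝ × UnitAddTorus d => realTrigPoly S (ζ p.1) p.2) = fun p =>
      ∑ k ∈ S, FunctionSpaces.EuclideanSpace.realPart (mFourier k p.2 • ζ p.1 k) := by
    funext p; exact realTrigPoly_apply_eq_sum S _ _
  rw [h]
  refine continuousOn_finsetSum _ fun k hk => ?_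
  refine FunctionSpaces.EuclideanSpace.realPart.continuous.comp_continuousOn ?_
  exact ((mFourier k).continuous.comp continuous_snd).continuousOn.smul
    ((hζ k hk).comp continuousOn_fst fun p hp => hp.1)

omit [DecidableEq d] in
/-- The zero-extended coefficients of a curve continuous on `I` are continuous on `I`. [folklore] -/
theorem continuousOn_coeffExt_apply {α : ℝ → ↥S → EuclideanSpace ℂ d} (hα : ContinuousOn α I)
    (l : d → ℤ) : ContinuousOn (fun s => coeffExt S (α s) l) I := by
  by_cases hl : l ∈ S
  · have h : (fun s => coeffExt S (α s) l) = fun s => α s ⟨l, hl⟩ := funext fun s => coeffExt_of_mem _ hl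
    rw [h]
    exact (continuous_apply (⟨l, hl⟩ : ↥S)).comp_continuousOn hα
  · simp_rw [coeffExt_of_not_mem _ hl]
    exact continuousOn_const

omit [DecidableEq d] in
/-- Joint continuity of the Galerkin field `(s, x) ↦ realTrigPoly S (α s)‾ x` along a
coefficient curve continuous on `I`. [folklore] -/
theorem continuousOn_galerkin_prod {α : ℝ → ↥S → EuclideanSpace ℂ d} (hα : ContinuousOn α I) :
    ContinuousOn (fun p : ℝ × UnitAddTorus d => realTrigPoly S (coeffExt S (α p.1)) p.2) (I ×ˢ univ) :=
  continuousOn_realTrigPoly_prod (ζ := fun s => coeffExt S (α s)) fun k _ =>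
    continuousOn_coeffExt_apply hα k

/-- Joint continuity of the partial derivatives `(s, x) ↦ ∂ⱼ (realTrigPoly S (α s)‾) x`. [folklore] -/
theorem continuousOn_partialDeriv_galerkin_prod {α : ℝ → ↥S → EuclideanSpace ℂ d}
    (hα : ContinuousOn α I) (j : d) :
    ContinuousOn (fun p : ℝ × UnitAddTorus d =>
      FunctionSpaces.Torus.partialDeriv j (realTrigPoly S (coeffExt S (α p.1))) p.2) (I ×ˢ univ) := by
  simp_rw [partialDeriv_realTrigPoly]
  exact continuousOn_realTrigPoly_prod
    (ζ := fun s k => (2 * Real.pi * Complex.I * (k j : ℂ)) • coeffExt S (α s) k) fun k _ =>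
    (continuousOn_coeffExt_apply hα k).const_smul (2 * Real.pi * Complex.I * (k j : ℂ))

/-- Joint continuity of the Laplacian `(s, x) ↦ Δ(realTrigPoly S (α s)‾) x`
(`Δ` acts diagonally on the modes, `laplacian_realTrigPoly`). [folklore] -/
theorem continuousOn_laplacian_galerkin_prod {α : ℝ → ↥S → EuclideanSpace ℂ d}
    (hα : ContinuousOn α I) :
    ContinuousOn (fun p : ℝ × UnitAddTorus d =>
      FunctionSpaces.Torus.laplacian (realTrigPoly S (coeffExt S (α p.1))) p.2) (I ×ˢ univ) := by
  simp_rw [laplacian_realTrigPoly]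
  exact continuousOn_realTrigPoly_prod
    (ζ := fun s k => -(((4 * Real.pi ^ 2 * freqNormSq k : ℝ) : ℂ) • coeffExt S (α s) k)) fun k _ =>
    ((continuousOn_coeffExt_apply hα k).const_smul (((4 * Real.pi ^ 2 * freqNormSq k : ℝ) : ℂ))).neg

/-- Joint continuity of the self-convection `(s, x) ↦ ((U·∇)U)(s, x)` of the Galerkin field
`U(s) = realTrigPoly S (α s)‾`. [folklore] -/
theorem continuousOn_convect_galerkin_prod {α : ℝ → ↥S → EuclideanSpace ℂ d}
    (hα : ContinuousOn α I) :
    ContinuousOn (fun p : ℝ × UnitAddTorus d =>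
      FunctionSpaces.Torus.convect (realTrigPoly S (coeffExt S (α p.1)))
        (realTrigPoly S (coeffExt S (α p.1))) p.2) (I ×ˢ univ) := by
  have h : (fun p : ℝ × UnitAddTorus d =>
      FunctionSpaces.Torus.convect (realTrigPoly S (coeffExt S (α p.1)))
        (realTrigPoly S (coeffExt S (α p.1))) p.2) = fun p =>
      ∑ j, (realTrigPoly S (coeffExt S (α p.1)) p.2) j •
        FunctionSpaces.Torus.partialDeriv j (realTrigPoly S (coeffExt S (α p.1))) p.2 := by
    funext p
    exact convect_eq_sum_smul_partialDeriv ((isSmooth_realTrigPoly S _).isContDiff (by simp)) _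
  rw [h]
  refine continuousOn_finsetSum _ fun j _ => ?_
  exact ((EuclideanSpace.proj (𝕜 := ℝ) j).continuous.comp_continuousOn
    (continuousOn_galerkin_prod hα)).smul (continuousOn_partialDeriv_galerkin_prod hα j)

omit [DecidableEq d] in
/-- The convection symbol along a coefficient curve continuous on `I` is continuous on `I`. [folklore] -/
theorem continuousOn_convectionCoeff_curve {α : ℝ → ↥S → EuclideanSpace ℂ d} (hα : ContinuousOn α I)
    (k : d → ℤ) :
    ContinuousOn (fun s => convectionCoeff S (coeffExt S (α s)) (coeffExt S (α s)) k) I := by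
  have hc : ∀ l, ContinuousOn (fun s => coeffExt S (α s) l) I := continuousOn_coeffExt_apply hα
  simp_rw [continuousOn_iff_continuous_restrict] at hc ⊢
  exact continuous_convectionCoeff (C := fun s : I => coeffExt S (α s)) (C' := fun s : I => coeffExt S (α s))
    hc hc k

omit [DecidableEq d] in
/-- Joint continuity of the truncated self-convection
`(s, x) ↦ realTrigPoly S (convectionCoeff S (α s)‾ (α s)‾) x = P_S((U·∇)U)(s, x)`. [folklore] -/
theorem continuousOn_truncConvect_galerkin_prod {α : ℝ → ↥S → EuclideanSpace ℂ d}
    (hα : ContinuousOn α I) :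
    ContinuousOn (fun p : ℝ × UnitAddTorus d =>
      realTrigPoly S (convectionCoeff S (coeffExt S (α p.1)) (coeffExt S (α p.1))) p.2) (I ×ˢ univ) :=
  continuousOn_realTrigPoly_prod
    (ζ := fun s => convectionCoeff S (coeffExt S (α s)) (coeffExt S (α s))) fun k _ =>
    continuousOn_convectionCoeff_curve hα k

omit [DecidableEq d] in
/-- Continuity in time of the dissipation of the Galerkin field: `s ↦ ‖∇U(s)‖₂²` (real, finite
sum of squares of the coefficients) for a real coefficient curve continuous on `I`. [folklore] -/
theorem continuousOn_toReal_eGradNormSq_galerkin (hS : ∀ k ∈ S, -k ∈ S)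
    {α : ℝ → ↥S → EuclideanSpace ℂ d} (hα : ContinuousOn α I) (hreal : ∀ s ∈ I, IsRealCoeff (α s)) :
    ContinuousOn (fun s => (eGradNormSq (realTrigPoly S (coeffExt S (α s)))).toReal) I := by
  have h : ContinuousOn (fun s => 4 * Real.pi ^ 2 * ∑ k : ↥S, freqNormSq (k : d → ℤ) * ‖α s k‖ ^ 2) I := by
    refine continuousOn_const.mul (continuousOn_finsetSum _ fun k _ => continuousOn_const.mul ?_)
    exact ((continuous_apply k).comp_continuousOn hα).norm.pow 2
  refine h.congr fun s hs => ?_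
  exact toReal_eGradNormSq_coeffExt hS (hreal s hs)

omit [Fintype d] [DecidableEq d] in
/-- A function continuous on `[0, T] × T^d` is bounded there. [folklore] -/
theorem exists_forall_norm_le_of_continuousOn_prod {E : Type*} [NormedAddCommGroup E] {T : ℝ}
    {F : ℝ × UnitAddTorus d → E} (hF : ContinuousOn F (Icc 0 T ×ˢ univ)) :
    ∃ K : ℝ, 0 ≤ K ∧ ∀ s ∈ Icc 0 T, ∀ x, ‖F (s, x)‖ ≤ K := by
  obtain ⟨K, hK⟩ := (isCompact_Icc.prod isCompact_univ).exists_bound_of_continuousOn hF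
  exact ⟨|K|, abs_nonneg K, fun s hs x => (hK (s, x) ⟨hs, mem_univ x⟩).trans (le_abs_self K)⟩

end Curve

/-! ### Measurability and integrability in time of the slice functionals -/

section Time

variable {d : Type*} [Fintype d] [DecidableEq d] {S : Finset (d → ℤ)}

variable {T ν : ℝ} {f u : ℝ → UnitAddTorus d → EuclideanSpace ℝ d}
  {u₀ : UnitAddTorus d → EuclideanSpace ℝ d}

omit [DecidableEq d] in
/-- A function continuous on `[0, T] × T^d` is a.e.-strongly measurable for the product of
Lebesgue measure on `(0, T)` with the Haar measure (torus twin of the accepted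
`aestronglyMeasurable_prod_of_continuousOn`). [folklore] -/
theorem Torus.aestronglyMeasurable_prod_of_continuousOn_Icc {E : Type*} [TopologicalSpace E]
    [TopologicalSpace.PseudoMetrizableSpace E] {T : ℝ} {F : ℝ × UnitAddTorus d → E}
    (hF : ContinuousOn F (Icc 0 T ×ˢ univ)) :
    AEStronglyMeasurable F ((volume.restrict (Ioo 0 T)).prod volume) := by
  have h : AEStronglyMeasurable F (volume.restrict (Ioo 0 T ×ˢ (univ : Set (UnitAddTorus d)))) :=
    (hF.mono (prod_mono Ioo_subset_Icc_self subset_rfl)).aestronglyMeasurable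
      (measurableSet_Ioo.prod MeasurableSet.univ)
  rwa [Measure.volume_eq_prod, ← Measure.prod_restrict, Measure.restrict_univ] at h

omit [DecidableEq d] in
/-- **`s ↦ ∫ ‖u(s) - Z(s)‖²` is integrable on `(0, T)`** for a Leray–Hopf solution `u` and a
field `Z` continuous on `[0, T] × T^d` (measurable by Fubini, bounded a.e. by
`2 sup ∫‖u(s)‖² + 2‖Z‖²_∞`). [folklore] -/
theorem Torus.IsLerayHopfOn.integrableOn_integral_norm_sub_sq [DecidableEq d] (hu : Torus.IsLerayHopfOn T ν f u₀ u)
    {Z : ℝ → UnitAddTorus d → EuclideanSpace ℝ d} (hZ : ContinuousOn (uncurry Z) (Icc 0 T ×ˢ univ)) :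
    IntegrableOn (fun s => ∫ x, ‖u s x - Z s x‖ ^ 2) (Ioo 0 T) := by
  obtain ⟨C, -, hC⟩ := hu.exists_integral_norm_sq_le
  obtain ⟨K, hK0, hK⟩ := exists_forall_norm_le_of_continuousOn_prod hZ
  have hmeas : AEStronglyMeasurable (fun s => ∫ x, ‖u s x - Z s x‖ ^ 2) (volume.restrict (Ioo 0 T)) := by
    have h1 : AEStronglyMeasurable (fun p : ℝ × UnitAddTorus d => ‖uncurry u p - uncurry Z p‖ ^ 2)
        ((volume.restrict (Ioo 0 T)).prod volume) :=
      ((hu.aestronglyMeasurable_uncurry.sub (Torus.aestronglyMeasurable_prod_of_continuousOn_Icc hZ)).norm.pow 2)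
    exact h1.integral_prod_right'
  have : IsFiniteMeasure (volume.restrict (Ioo (0 : ℝ) T)) := ⟨by
    rw [Measure.restrict_apply_univ]; exact measure_Ioo_lt_top⟩
  refine ⟨hmeas, ?_⟩
  refine HasFiniteIntegral.mono' (g := fun _ => 2 * C + 2 * K ^ 2) (integrable_const _).hasFiniteIntegral ?_
  filter_upwards [hC, ae_restrict_mem measurableSet_Ioo] with s hs hsI
  have hmem : MemLp (u s) 2 volume := hu.memLp s (Ioo_subset_Icc_self hsI)
  have hi1 := hmem.integrable_norm_pow two_ne_zero
  rw [Real.norm_eq_abs, abs_of_nonneg (integral_nonneg fun x => sq_nonneg _)]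
  calc ∫ x, ‖u s x - Z s x‖ ^ 2 ≤ ∫ x, (2 * ‖u s x‖ ^ 2 + 2 * K ^ 2) := by
        refine integral_mono_of_nonneg (ae_of_all _ fun x => sq_nonneg _)
          ((hi1.const_mul 2).add (integrable_const _)) (ae_of_all _ fun x => ?_)
        have hZx : ‖Z s x‖ ≤ K := hK s (Ioo_subset_Icc_self hsI) x
        have h1 : ‖u s x - Z s x‖ ≤ ‖u s x‖ + K := (norm_sub_le _ _).trans (by linarith)
        have h2 : 0 ≤ ‖u s x‖ := norm_nonneg _
        nlinarith [norm_nonneg (u s x - Z s x), sq_nonneg (‖u s x‖ - K)]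
    _ = 2 * (∫ x, ‖u s x‖ ^ 2) + 2 * K ^ 2 := by
        rw [integral_add (hi1.const_mul 2) (integrable_const _), integral_const_mul, integral_const]
        simp
    _ ≤ 2 * C + 2 * K ^ 2 := by linarith

omit [DecidableEq d] in
/-- **`s ↦ ∫ ⟪u(s), Z(s)⟫` is integrable on `(0, T)`** for a Leray–Hopf solution `u` and a field
`Z` continuous on `[0, T] × T^d`. [folklore] -/
theorem Torus.IsLerayHopfOn.integrableOn_integral_inner_prod [DecidableEq d] (hu : Torus.IsLerayHopfOn T ν f u₀ u)
    {Z : ℝ → UnitAddTorus d → EuclideanSpace ℝ d} (hZ : ContinuousOn (uncurry Z) (Icc 0 T ×ˢ univ)) :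
    IntegrableOn (fun s => ∫ x, ⟪u s x, Z s x⟫) (Ioo 0 T) := by
  obtain ⟨C, -, hC⟩ := hu.exists_integral_norm_sq_le
  obtain ⟨K, hK0, hK⟩ := exists_forall_norm_le_of_continuousOn_prod hZ
  have hmeas : AEStronglyMeasurable (fun s => ∫ x, ⟪u s x, Z s x⟫) (volume.restrict (Ioo 0 T)) := by
    have h1 : AEStronglyMeasurable (fun p : ℝ × UnitAddTorus d => ⟪uncurry u p, uncurry Z p⟫)
        ((volume.restrict (Ioo 0 T)).prod volume) :=
      hu.aestronglyMeasurable_uncurry.inner (Torus.aestronglyMeasurable_prod_of_continuousOn_Icc hZ)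
    exact h1.integral_prod_right'
  have : IsFiniteMeasure (volume.restrict (Ioo (0 : ℝ) T)) := ⟨by
    rw [Measure.restrict_apply_univ]; exact measure_Ioo_lt_top⟩
  refine ⟨hmeas, ?_⟩
  refine HasFiniteIntegral.mono' (g := fun _ => K * (2⁻¹ * (1 + C))) (integrable_const _).hasFiniteIntegral ?_
  filter_upwards [hC, ae_restrict_mem measurableSet_Ioo] with s hs hsI
  have hmem : MemLp (u s) 2 volume := hu.memLp s (Ioo_subset_Icc_self hsI)
  rw [Real.norm_eq_abs]
  refine (abs_integral_inner_le_of_norm_le (hmem.integrable one_le_two) (hK s (Ioo_subset_Icc_self hsI))).trans ?_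
  refine mul_le_mul_of_nonneg_left ((integral_norm_le_of_memLp_two hmem).trans ?_) hK0
  gcongr

/-- **`s ↦ ∫ ⟪u(s), ΔU(s)⟫` is integrable on `(0, T)`** for the Galerkin field
`U(s) = realTrigPoly S (α s)‾` along a coefficient curve continuous on `[0, T]`. [folklore] -/
theorem Torus.IsLerayHopfOn.integrableOn_integral_inner_laplacian_galerkin (hu : Torus.IsLerayHopfOn T ν f u₀ u)
    {α : ℝ → ↥S → EuclideanSpace ℂ d} (hα : ContinuousOn α (Icc 0 T)) :
    IntegrableOn (fun s => ∫ x, ⟪u s x,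
      FunctionSpaces.Torus.laplacian (realTrigPoly S (coeffExt S (α s))) x⟫) (Ioo 0 T) :=
  hu.integrableOn_integral_inner_prod (Z := fun s x => FunctionSpaces.Torus.laplacian
    (realTrigPoly S (coeffExt S (α s))) x) (continuousOn_laplacian_galerkin_prod hα)

/-- **The trilinear slice functional `s ↦ ∫ ⟪u(s) - U(s), ((u(s) - U(s))·∇)U(s)⟫` is integrable
on `(0, T)`** for a Leray–Hopf solution `u` and a Galerkin field `U(s) = realTrigPoly S (α s)‾`
along a coefficient curve continuous on `[0, T]` (jointly measurable integrand, bounded by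
`(sup ∑ᵢ ‖∂ᵢU‖) ∫ ‖u(s) - U(s)‖²`). [folklore] -/
theorem Torus.IsLerayHopfOn.integrableOn_trilinear_sub_galerkin (hu : Torus.IsLerayHopfOn T ν f u₀ u)
    {α : ℝ → ↥S → EuclideanSpace ℂ d} (hα : ContinuousOn α (Icc 0 T)) :
    IntegrableOn (fun s => ∫ x, ⟪u s x - realTrigPoly S (coeffExt S (α s)) x,
      FunctionSpaces.Torus.convect (u s - realTrigPoly S (coeffExt S (α s)))
        (realTrigPoly S (coeffExt S (α s))) x⟫) (Ioo 0 T) := by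
  set U : ℝ → UnitAddTorus d → EuclideanSpace ℝ d := fun s => realTrigPoly S (coeffExt S (α s)) with hU_def
  have hUc : ContinuousOn (uncurry U) (Icc 0 T ×ˢ univ) := continuousOn_galerkin_prod hα
  have hUs : ∀ s, FunctionSpaces.Torus.IsSmooth (U s) := fun s => isSmooth_realTrigPoly S _
  -- the bound on the derivatives
  have hDc : ContinuousOn (fun p : ℝ × UnitAddTorus d =>
      ∑ j, ‖FunctionSpaces.Torus.partialDeriv j (U p.1) p.2‖) (Icc 0 T ×ˢ univ) :=
    continuousOn_finsetSum _ fun j _ => (continuousOn_partialDeriv_galerkin_prod hα j).norm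
  obtain ⟨D, hD0, hD'⟩ := exists_forall_norm_le_of_continuousOn_prod hDc
  have hD : ∀ s ∈ Icc 0 T, ∀ x, ∑ j, ‖FunctionSpaces.Torus.partialDeriv j (U s) x‖ ≤ D :=
    fun s hs x => (Real.le_norm_self _).trans (hD' s hs x)
  -- measurability
  have hw : AEStronglyMeasurable (fun p : ℝ × UnitAddTorus d => u p.1 p.2 - U p.1 p.2)
      ((volume.restrict (Ioo 0 T)).prod volume) :=
    hu.aestronglyMeasurable_uncurry.sub (Torus.aestronglyMeasurable_prod_of_continuousOn_Icc hUc)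
  have hrepr : ∀ p : ℝ × UnitAddTorus d, ⟪u p.1 p.2 - U p.1 p.2,
      FunctionSpaces.Torus.convect (u p.1 - U p.1) (U p.1) p.2⟫ =
      ∑ j, (u p.1 p.2 - U p.1 p.2) j * ⟪u p.1 p.2 - U p.1 p.2, FunctionSpaces.Torus.partialDeriv j (U p.1) p.2⟫ := by
    intro p
    simp only [FunctionSpaces.Torus.convect]
    rw [fderiv_apply_eq_sum_partialDeriv ((hUs p.1).isContDiff (by simp)), inner_sum]
    refine Finset.sum_congr rfl fun j _ => ?_
    rw [real_inner_smul_right]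
    rfl
  have hmeasF : AEStronglyMeasurable (fun p : ℝ × UnitAddTorus d => ⟪u p.1 p.2 - U p.1 p.2,
      FunctionSpaces.Torus.convect (u p.1 - U p.1) (U p.1) p.2⟫) ((volume.restrict (Ioo 0 T)).prod volume) := by
    simp_rw [hrepr]
    refine Finset.aestronglyMeasurable_fun_sum _ fun j _ => ?_
    exact ((EuclideanSpace.proj (𝕜 := ℝ) j).continuous.comp_aestronglyMeasurable hw).mul
      (hw.inner (Torus.aestronglyMeasurable_prod_of_continuousOn_Icc (continuousOn_partialDeriv_galerkin_prod hα j)))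
  have hmeas := hmeasF.integral_prod_right'
  -- the bound by `D ∫ ‖u s - U s‖²`
  have hW := hu.integrableOn_integral_norm_sub_sq hUc
  refine Integrable.mono' (hW.const_mul D) hmeas ?_
  filter_upwards [ae_restrict_mem measurableSet_Ioo] with s hs
  have hsI : s ∈ Icc 0 T := Ioo_subset_Icc_self hs
  have hmem : MemLp (u s) 2 volume := hu.memLp s hsI
  have hwmem : MemLp (fun x => u s x - U s x) 2 volume := hmem.sub ((hUs s).memLp 2)
  have hpt : ∀ x, ‖⟪u s x - U s x, FunctionSpaces.Torus.convect (u s - U s) (U s) x⟫‖ ≤ D * ‖u s x - U s x‖ ^ 2 := by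
    intro x
    rw [Real.norm_eq_abs]
    refine (abs_real_inner_le_norm _ _).trans ?_
    have h1 := norm_convect_le (u s - U s) ((hUs s).isContDiff (by simp)) x
    have h2 : ‖FunctionSpaces.Torus.convect (u s - U s) (U s) x‖ ≤ ‖u s x - U s x‖ * D :=
      h1.trans (mul_le_mul (le_of_eq rfl) (hD s hsI x) (Finset.sum_nonneg fun _ _ => norm_nonneg _) (norm_nonneg _))
    calc ‖u s x - U s x‖ * ‖FunctionSpaces.Torus.convect (u s - U s) (U s) x‖
        ≤ ‖u s x - U s x‖ * (‖u s x - U s x‖ * D) := mul_le_mul_of_nonneg_left h2 (norm_nonneg _)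
      _ = D * ‖u s x - U s x‖ ^ 2 := by ring
  calc ‖∫ x, ⟪u s x - U s x, FunctionSpaces.Torus.convect (u s - U s) (U s) x⟫‖
      ≤ ∫ x, ‖⟪u s x - U s x, FunctionSpaces.Torus.convect (u s - U s) (U s) x⟫‖ := norm_integral_le_integral_norm _
    _ ≤ ∫ x, D * ‖u s x - U s x‖ ^ 2 := integral_mono_of_nonneg (ae_of_all _ fun x => norm_nonneg _)
        ((hwmem.integrable_norm_pow two_ne_zero).const_mul D) (ae_of_all _ hpt)
    _ = D * ∫ x, ‖u s x - U s x‖ ^ 2 := integral_const_mul _ _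

/-- **The truncation-error slice functional `s ↦ ∫ ⟪u(s) - P_S u(s), (U(s)·∇)U(s)⟫` is
integrable on `(0, T)`** for a real coefficient curve continuous on `[0, T]` on a symmetric `S`:
moving the truncation across the pairing (`integral_inner_sub_truncation_comm`), this is
`s ↦ ∫ ⟪u(s), (U·∇)U(s) - P_S((U·∇)U)(s)⟫` with a jointly continuous second factor
(`truncation_convect_galerkin_eq`). [folklore] -/
theorem Torus.IsLerayHopfOn.integrableOn_truncation_trilinear_galerkin (hu : Torus.IsLerayHopfOn T ν f u₀ u)
    (hS : ∀ k ∈ S, -k ∈ S) {α : ℝ → ↥S → EuclideanSpace ℂ d} (hα : ContinuousOn α (Icc 0 T))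
    (hreal : ∀ s ∈ Icc 0 T, IsRealCoeff (α s)) :
    IntegrableOn (fun s => ∫ x, ⟪u s x - realTrigPoly S (fun l => mFourierCoeff
        (FunctionSpaces.EuclideanSpace.complexify ∘ u s) l) x,
      FunctionSpaces.Torus.convect (realTrigPoly S (coeffExt S (α s))) (realTrigPoly S (coeffExt S (α s))) x⟫)
      (Ioo 0 T) := by
  have hZ : ContinuousOn (uncurry fun s x =>
      FunctionSpaces.Torus.convect (realTrigPoly S (coeffExt S (α s))) (realTrigPoly S (coeffExt S (α s))) x -
        realTrigPoly S (convectionCoeff S (coeffExt S (α s)) (coeffExt S (α s))) x) (Icc 0 T ×ˢ univ) :=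
    (continuousOn_convect_galerkin_prod hα).sub (continuousOn_truncConvect_galerkin_prod hα)
  refine (hu.integrableOn_integral_inner_prod hZ).congr_fun (fun s hs => ?_) measurableSet_Ioo
  have hsI : s ∈ Icc 0 T := Ioo_subset_Icc_self hs
  have hsm : FunctionSpaces.Torus.IsSmooth (realTrigPoly S (coeffExt S (α s))) := isSmooth_realTrigPoly S _
  dsimp only [uncurry]
  rw [integral_inner_sub_truncation_comm hS (hu.memLp s hsI) (hsm.convect hsm),
    truncation_convect_galerkin_eq hS (hreal s hsI)]

end Time

end Literature.Analysis.FluidPDE
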